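import Literature.Analysis.OperatorTheory.NelsonAPrioriEstimate
import Literature.NumberTheory.Automorphic.ArchCoordinatesGL
import Literature.NumberTheory.Automorphic.AutomorphicRepsGLAnalyticVectors
import Mathlib.MeasureTheory.Function.L2Space
import Mathlib.Analysis.Calculus.Deriv.Star
import Mathlib.MeasureTheory.Integral.Marginal
import Mathlib.MeasureTheory.Function.Jacobian
import HarnessLib

/-!
# The a-priori Nelson estimate on `GL_n(K_∞)`-orbits: all derivatives of a `Δ`-stable
# finite-dimensional space of smooth functions are locally square integrable, with the local
# bounds of the functions themselves

Topic `NumberTheory/Automorphic`. Let `W` be a Lie-stable space of continuous, archimedean-smooth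
functions on `GL_n(𝔸_K)` (`IsLieStableSmooth`, e.g. a stable space of automorphic forms,
`IsStableSubmodule.isLieStableSmooth_gl`), `X_p` the unit generators of a self-dual system of
units of `K_∞` (`RealCasimirGL.unitGen`; they span `𝔤` and are closed under brackets), and
`T ≤ W` a finite-dimensional subspace stable under Nelson's Laplacian `Δ = ∑_p X_p²` (every
`K_∞`-finite `Z(𝔤)`-finite element of a stable space of automorphic forms lies in such a `T`,
`IsStableSubmodule.exists_laplacian_stable`). For a base point `y ∈ GL_n(𝔸_K)` read the elements
of `W` on the orbit `g ↦ y · (g, 1)` of `GL_n(K_∞)` in the linear coordinates of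
`ArchCoordinatesGL`, and weight them by powers of the cut-off `χ` at `1`:

* `cutoffWeight hcpt m y φ = χ^{m+1} · orbitPull y φ`, its class `cutoffWeightLp` in
  `L²(coords, Lebesgue)` for continuous `φ`, and the complex linear **weight maps**
  `cutoffWeightMap hcpt hWc m y : W → L²`;
* `norm_cutoffWeightMap_succ_le` (**monotone**: `‖M_{m+1} φ‖ ≤ ‖M_m φ‖`, as `0 ≤ χ ≤ 1`) and
  `exists_norm_inner_lieDeriv_add_le` (**almost skew**: for `X ∈ 𝔤`,
  `|⟪M_{k+1}(Xf), M_{k+1} g⟫ + ⟪M_{k+1} f, M_{k+1}(Xg)⟫| ≤ D (k+2) ‖M_k f‖ ‖M_{k+1} g‖` — the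
  integration by parts along the flow of `X`: right translations are linear maps of the
  coordinate space, so Lebesgue measure has a constant divergence, `exists_flowDivergence`, and
  the derivative of the cut-off costs one power of `χ`);
* `coordSize bT` — the sup-norm of the coordinates in a finite basis `bT` of `T`, with the
  expansion `eq_sum_coord_smul_basis`, `norm_coord_le_coordSize`, and `exists_coordSize_map_le`
  (a linear map preserving `T` is bounded for it);
* `exists_norm_cutoffWeightMap_wordEnd_le` (**the a-priori estimate**): for `nw ≤ m` there is
  `C ≥ 0` such that for every `y`, every `Λ ≥ 0` with `‖M_0^{(y)} u‖ ≤ Λ size u` on `T`, every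
  word `β` of length `nw` in the `X_p` and every `u ∈ T`, `‖M_m^{(y)} (X_β u)‖ ≤ C Λ size u`.
  This is `Literature.Analysis.OperatorTheory.norm_weight_wordEnd_le` (Nelson's recursion in
  a-priori form) for the operators `φ ↦ X_p φ` on `W`.

With the Sobolev box lemma on `GL_n(K_∞)` (sequel) this gives the uniform moderate growth of the
elements of stable spaces of automorphic forms (Borel–Jacquet 4.3 (ii) / Moeglin–Waldspurger
I.2.17 for stable spaces) without Harish-Chandra's convolution identity or elliptic regularity.
Everything is proved; no named facts.

## References

* E. Nelson, *Analytic vectors*, Ann. of Math. 70 (1959), 572–615, §6 [Nelson1959] (not held).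
* M. P. Gaffney, *A special Stokes's theorem for complete Riemannian manifolds*, Ann. of Math. 60
  (1954), 140–145 (the cut-off device) (not held).
* Harish-Chandra, *Representations of a semisimple Lie group on a Banach space. I*, Trans. AMS 75
  (1953), Lemma 34 (p. 228) [HarishChandraTAMS1953] (held): the application.
-/

noncomputable section

open scoped MatrixGroups Matrix ContDiff Topology Classical InnerProductSpace
open Filter MeasureTheory NumberField NumberField.mixedEmbedding IsDedekindDomain Set

namespace Literature.NumberTheory.Automorphic

-- `M_n(K_∞)` is finite-dimensional over `ℝ` (a theorem used as a local instance, as in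
-- `TestFunctionLieDeriv`)
attribute [local instance] finiteDimensional_matrix_mixedSpace

-- Mathlib idiom (Mathlib/Algebra/Lie/OfAssociative.lean); needed to mention Lie subalgebras of matrix algebras
attribute [local instance 100] LieRing.ofAssociativeRing

variable {n : ℕ} {K : Type} [Field K] [NumberField K] (hcpt : isCompact_glFiniteIntegralLevel n K)

/-! ### 1. The weights `M_m φ = χ^{m+1} · (φ on the orbit of y)` in `L²` -/

section Weights

/-- The support of a power of the complex cut-off lies in the units. [folklore] -/
theorem tsupport_glCutoffC_pow_subset (m : ℕ) :
    tsupport (fun s : GlIdx n K → ℝ ↦ glCutoffC n K s ^ (m + 1)) ⊆ glUnitSet n K := by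
  have e : (fun s : GlIdx n K → ℝ ↦ glCutoffC n K s ^ (m + 1)) =
      (fun s ↦ glCutoffC n K s ^ m) * glCutoffC n K := by
    funext s; rw [Pi.mul_apply, pow_succ]
  rw [e]
  exact tsupport_mul_subset_right.trans tsupport_glCutoffC_subset

/-- A power of the complex cut-off is continuous. [folklore] -/
theorem continuous_glCutoffC_pow (m : ℕ) : Continuous fun s : GlIdx n K → ℝ ↦ glCutoffC n K s ^ m :=
  continuous_glCutoffC.pow m

/-- A positive power of the complex cut-off has compact support. [folklore] -/
theorem hasCompactSupport_glCutoffC_pow (m : ℕ) :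
    HasCompactSupport fun s : GlIdx n K → ℝ ↦ glCutoffC n K s ^ (m + 1) :=
  hasCompactSupport_glCutoffC.comp_left (g := fun z : ℂ ↦ z ^ (m + 1)) (zero_pow (Nat.succ_ne_zero m))

/-- `‖χ s ^ m‖ ≤ 1`. [folklore] -/
theorem norm_glCutoffC_pow_le_one (m : ℕ) (s : GlIdx n K → ℝ) : ‖glCutoffC n K s ^ m‖ ≤ 1 := by
  rw [norm_pow]; exact pow_le_one₀ (norm_nonneg _) (norm_glCutoffC_le_one s)

/-- `‖χ s ^ (m+1)‖ ≤ ‖χ s ^ m‖`. [folklore] -/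
theorem norm_glCutoffC_pow_succ_le (m : ℕ) (s : GlIdx n K → ℝ) :
    ‖glCutoffC n K s ^ (m + 1)‖ ≤ ‖glCutoffC n K s ^ m‖ := by
  rw [pow_succ, norm_mul]
  exact mul_le_of_le_one_right (norm_nonneg _) (norm_glCutoffC_le_one s)

/-- **The weight functions**: `M_m φ (s) = χ(s)^{m+1} · φ (y ι(val⁻¹ s))` (by `0` off the units),
for `φ : GL_n(𝔸_K) → ℂ`, `y ∈ GL_n(𝔸_K)`, `m ∈ ℕ`. Nelson 1959, §6, with Gaffney's cut-off. [folklore] -/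
def cutoffWeight (m : ℕ) (y : (AdelicGroupData.gl n K).Adelic) (φ : (AdelicGroupData.gl n K).Adelic → ℂ) :
    (GlIdx n K → ℝ) → ℂ :=
  fun s ↦ glCutoffC n K s ^ (m + 1) * orbitPull hcpt y φ s

/-- Unfolding of `cutoffWeight`. [folklore] -/
theorem cutoffWeight_apply (m : ℕ) (y : (AdelicGroupData.gl n K).Adelic) (φ : (AdelicGroupData.gl n K).Adelic → ℂ)
    (s : GlIdx n K → ℝ) : cutoffWeight hcpt m y φ s = glCutoffC n K s ^ (m + 1) * orbitPull hcpt y φ s := rfl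

/-- `cutoffWeight` is additive in `φ`. [folklore] -/
theorem cutoffWeight_add (m : ℕ) (y : (AdelicGroupData.gl n K).Adelic) (φ ψ : (AdelicGroupData.gl n K).Adelic → ℂ) :
    cutoffWeight hcpt m y (φ + ψ) = cutoffWeight hcpt m y φ + cutoffWeight hcpt m y ψ := by
  funext s
  simp only [cutoffWeight_apply, Pi.add_apply, orbitPull_add, mul_add]

/-- `cutoffWeight` is homogeneous in `φ`. [folklore] -/
theorem cutoffWeight_smul (m : ℕ) (y : (AdelicGroupData.gl n K).Adelic) (c : ℂ) (φ : (AdelicGroupData.gl n K).Adelic → ℂ) :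
    cutoffWeight hcpt m y (c • φ) = c • cutoffWeight hcpt m y φ := by
  funext s
  simp only [cutoffWeight_apply, Pi.smul_apply, orbitPull_smul, smul_eq_mul]
  ring

/-- `cutoffWeight m y φ` is continuous for continuous `φ`. [folklore] -/
theorem continuous_cutoffWeight (m : ℕ) (y : (AdelicGroupData.gl n K).Adelic) {φ : (AdelicGroupData.gl n K).Adelic → ℂ}
    (hφ : Continuous φ) : Continuous (cutoffWeight hcpt m y φ) :=
  continuous_mul_unitPull_of_tsupport_subset (continuous_glCutoffC_pow (m + 1)) (tsupport_glCutoffC_pow_subset m)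
    (continuous_orbit hcpt hφ y)

/-- `cutoffWeight m y φ` has compact support. [folklore] -/
theorem hasCompactSupport_cutoffWeight (m : ℕ) (y : (AdelicGroupData.gl n K).Adelic)
    (φ : (AdelicGroupData.gl n K).Adelic → ℂ) : HasCompactSupport (cutoffWeight hcpt m y φ) :=
  (hasCompactSupport_glCutoffC_pow m).mul_right

/-- `cutoffWeight m y φ ∈ ℒ²` for continuous `φ`. [folklore] -/
theorem memLp_cutoffWeight (m : ℕ) (y : (AdelicGroupData.gl n K).Adelic) {φ : (AdelicGroupData.gl n K).Adelic → ℂ}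
    (hφ : Continuous φ) : MemLp (cutoffWeight hcpt m y φ) 2 (volume : Measure (GlIdx n K → ℝ)) :=
  (continuous_cutoffWeight hcpt m y hφ).memLp_of_hasCompactSupport (hasCompactSupport_cutoffWeight hcpt m y φ)

/-- Pointwise monotonicity in the weight: `‖M_{m+1} φ (s)‖ ≤ ‖M_m φ (s)‖`. [folklore] -/
theorem norm_cutoffWeight_succ_le (m : ℕ) (y : (AdelicGroupData.gl n K).Adelic) (φ : (AdelicGroupData.gl n K).Adelic → ℂ)
    (s : GlIdx n K → ℝ) : ‖cutoffWeight hcpt (m + 1) y φ s‖ ≤ ‖cutoffWeight hcpt m y φ s‖ := by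
  rw [cutoffWeight_apply, cutoffWeight_apply, norm_mul, norm_mul]
  exact mul_le_mul_of_nonneg_right (norm_glCutoffC_pow_succ_le _ s) (norm_nonneg _)

/-- **The weights as elements of `L²`**: `cutoffWeightLp m y φ = [χ^{m+1} (φ ∘ orbit)] ∈ L²(coords)`,
for continuous `φ`. [folklore] -/
def cutoffWeightLp (m : ℕ) (y : (AdelicGroupData.gl n K).Adelic) {φ : (AdelicGroupData.gl n K).Adelic → ℂ}
    (hφ : Continuous φ) : Lp ℂ 2 (volume : Measure (GlIdx n K → ℝ)) :=
  (memLp_cutoffWeight hcpt m y hφ).toLp _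

/-- `cutoffWeightLp m y φ = M_m φ` almost everywhere. [folklore] -/
theorem coeFn_cutoffWeightLp (m : ℕ) (y : (AdelicGroupData.gl n K).Adelic) {φ : (AdelicGroupData.gl n K).Adelic → ℂ}
    (hφ : Continuous φ) : (cutoffWeightLp hcpt m y hφ : (GlIdx n K → ℝ) → ℂ) =ᵐ[volume] cutoffWeight hcpt m y φ :=
  MemLp.coeFn_toLp _

/-- **Monotonicity of the weights**: `‖cutoffWeightLp (m+1) y φ‖ ≤ ‖cutoffWeightLp m y φ‖`. [folklore] -/
theorem norm_cutoffWeightLp_succ_le (m : ℕ) (y : (AdelicGroupData.gl n K).Adelic) {φ : (AdelicGroupData.gl n K).Adelic → ℂ}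
    (hφ : Continuous φ) : ‖cutoffWeightLp hcpt (m + 1) y hφ‖ ≤ ‖cutoffWeightLp hcpt m y hφ‖ := by
  refine Lp.norm_le_norm_of_ae_le ?_
  filter_upwards [coeFn_cutoffWeightLp hcpt (m + 1) y hφ, coeFn_cutoffWeightLp hcpt m y hφ] with s h1 h2
  rw [h1, h2]
  exact norm_cutoffWeight_succ_le hcpt m y φ s

/-- **Inner products of weights are integrals**: `⟪cutoffWeightLp m y φ, cutoffWeightLp m y ψ⟫ =
∫ conj (M_m φ) · M_m ψ`. [folklore] -/
theorem inner_cutoffWeightLp (m : ℕ) (y : (AdelicGroupData.gl n K).Adelic) {φ ψ : (AdelicGroupData.gl n K).Adelic → ℂ}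
    (hφ : Continuous φ) (hψ : Continuous ψ) :
    ⟪cutoffWeightLp hcpt m y hφ, cutoffWeightLp hcpt m y hψ⟫_ℂ =
      ∫ s, star (cutoffWeight hcpt m y φ s) * cutoffWeight hcpt m y ψ s := by
  rw [L2.inner_def]
  refine integral_congr_ae ?_
  filter_upwards [coeFn_cutoffWeightLp hcpt m y hφ, coeFn_cutoffWeightLp hcpt m y hψ] with s h1 h2
  rw [h1, h2, RCLike.inner_apply']
  rfl

/-- A pointwise comparison gives a comparison of `L²`-norms with a weight: if
`‖F s‖ ≤ C ‖cutoffWeight m y φ s‖` everywhere, `F ∈ ℒ²`, then `‖[F]‖ ≤ C ‖cutoffWeightLp m y φ‖`. [folklore] -/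
theorem norm_toLp_le_mul_norm_cutoffWeightLp (m : ℕ) (y : (AdelicGroupData.gl n K).Adelic)
    {φ : (AdelicGroupData.gl n K).Adelic → ℂ} (hφ : Continuous φ) {F : (GlIdx n K → ℝ) → ℂ}
    (hF : MemLp F 2 (volume : Measure (GlIdx n K → ℝ))) {C : ℝ}
    (hle : ∀ s, ‖F s‖ ≤ C * ‖cutoffWeight hcpt m y φ s‖) : ‖hF.toLp F‖ ≤ C * ‖cutoffWeightLp hcpt m y hφ‖ := by
  refine Lp.norm_le_mul_norm_of_ae_le_mul ?_
  filter_upwards [hF.coeFn_toLp, coeFn_cutoffWeightLp hcpt m y hφ] with s h1 h2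
  rw [h1, h2]
  exact hle s

omit [NumberField K] in
/-- **Inner products of `L²`-classes of functions are integrals**: `⟪[u], [v]⟫ = ∫ conj u · v`.
[folklore] -/
theorem inner_toLp_toLp_eq_integral_star_mul {u v : (GlIdx n K → ℝ) → ℂ} (hu : MemLp u 2 (volume : Measure (GlIdx n K → ℝ)))
    (hv : MemLp v 2 (volume : Measure (GlIdx n K → ℝ))) :
    ⟪hu.toLp u, hv.toLp v⟫_ℂ = ∫ s, star (u s) * v s := by
  rw [L2.inner_def]
  refine integral_congr_ae ?_
  filter_upwards [hu.coeFn_toLp, hv.coeFn_toLp] with s h1 h2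
  rw [h1, h2, RCLike.inner_apply']
  rfl

/-- Powers of the complex cut-off are real: `conj (χ s ^ k) = χ s ^ k`. [folklore] -/
theorem star_glCutoffC_pow (k : ℕ) (s : GlIdx n K → ℝ) : star (glCutoffC n K s ^ k) = glCutoffC n K s ^ k := by
  rw [star_pow, star_glCutoffC]

/-- `rFlow (exp 0X) s = s`. [folklore] -/
theorem rFlow_expGL_zero_smul (X : Matrix (Fin n) (Fin n) (mixedSpace K)) (s : GlIdx n K → ℝ) :
    rFlow (expGL ((0 : ℝ) • X) : Matrix (Fin n) (Fin n) (mixedSpace K)) s = s := by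
  rw [zero_smul, expGL_zero, Units.val_one, rFlow_one, LinearMap.id_apply]

/-- Cut-off prefactors `c · χ^{j+1} · χ'` are supported in the units. [folklore] -/
theorem tsupport_const_mul_glCutoffC_pow_mul_subset (c : ℂ) (j : ℕ) (X : Matrix (Fin n) (Fin n) (mixedSpace K)) :
    tsupport (fun s : GlIdx n K → ℝ ↦ c * glCutoffC n K s ^ (j + 1) * glCutoffDerivC X s) ⊆ glUnitSet n K := by
  have e : (fun s : GlIdx n K → ℝ ↦ c * glCutoffC n K s ^ (j + 1) * glCutoffDerivC X s) =
      ((fun _ ↦ c) * fun s ↦ glCutoffC n K s ^ (j + 1)) * glCutoffDerivC X := by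
    funext s; simp only [Pi.mul_apply]
  rw [e]
  exact tsupport_mul_subset_left.trans (tsupport_mul_subset_right.trans (tsupport_glCutoffC_pow_subset j))

end Weights

/-! ### 2. The weight maps on a Lie-stable space of continuous smooth functions; almost skewness -/

section Defect

variable {W : Submodule ℂ ((AdelicGroupData.gl n K).Adelic → ℂ)}
  (h : IsLieStableSmooth (AutomorphyDatum.gl n K hcpt) W) (hWc : ∀ φ ∈ W, Continuous φ)

/-- **The weight maps** `M_m^{(y)} : W → L²`, `φ ↦ [χ^{m+1} (φ ∘ orbit of y)]`, complex linear.
Nelson 1959, §6 (with Gaffney's cut-off). [folklore] -/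
def cutoffWeightMap (m : ℕ) (y : (AdelicGroupData.gl n K).Adelic) :
    W →ₗ[ℂ] Lp ℂ 2 (volume : Measure (GlIdx n K → ℝ)) where
  toFun φ := cutoffWeightLp hcpt m y (hWc φ φ.2)
  map_add' φ ψ := by
    apply Lp.ext
    filter_upwards [coeFn_cutoffWeightLp hcpt m y (hWc _ (φ + ψ).2), coeFn_cutoffWeightLp hcpt m y (hWc φ φ.2),
      coeFn_cutoffWeightLp hcpt m y (hWc ψ ψ.2),
      Lp.coeFn_add (cutoffWeightLp hcpt m y (hWc φ φ.2)) (cutoffWeightLp hcpt m y (hWc ψ ψ.2))] with s h1 h2 h3 h4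
    rw [h4, Pi.add_apply, h1, h2, h3, Submodule.coe_add, cutoffWeight_add, Pi.add_apply]
  map_smul' c φ := by
    apply Lp.ext
    filter_upwards [coeFn_cutoffWeightLp hcpt m y (hWc _ (c • φ).2), coeFn_cutoffWeightLp hcpt m y (hWc φ φ.2),
      Lp.coeFn_smul c (cutoffWeightLp hcpt m y (hWc φ φ.2))] with s h1 h2 h3
    rw [RingHom.id_apply, h3, Pi.smul_apply, h1, h2, Submodule.coe_smul, cutoffWeight_smul, Pi.smul_apply]

/-- Unfolding of `cutoffWeightMap`. [folklore] -/
theorem cutoffWeightMap_apply (m : ℕ) (y : (AdelicGroupData.gl n K).Adelic) (φ : W) :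
    cutoffWeightMap hcpt hWc m y φ = cutoffWeightLp hcpt m y (hWc φ φ.2) := rfl

/-- **Monotonicity**: `‖M_{m+1} φ‖ ≤ ‖M_m φ‖`. [folklore] -/
theorem norm_cutoffWeightMap_succ_le (m : ℕ) (y : (AdelicGroupData.gl n K).Adelic) (φ : W) :
    ‖cutoffWeightMap hcpt hWc (m + 1) y φ‖ ≤ ‖cutoffWeightMap hcpt hWc m y φ‖ :=
  norm_cutoffWeightLp_succ_le hcpt m y (hWc φ φ.2)

include h in
/-- **Almost skewness of the Lie derivatives for the weights** (the integration by parts of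
Nelson 1959, §6, with Gaffney's cut-off): for `X ∈ 𝔤` there is `D ≥ 0` such that for all `k`,
`y`, `f, g ∈ W`,
`|⟪M_{k+1}(X f), M_{k+1} g⟫ + ⟪M_{k+1} f, M_{k+1}(X g)⟫| ≤ D (k+2) ‖M_k f‖ ‖M_{k+1} g‖`.
Proof: with `Ψ = χ^{2k+4} conj(f) g` on the orbit, `∫ Ψ' = κ ∫ Ψ` (`exists_flowDivergence`), and
`Ψ' = (2k+4) χ^{2k+3} χ' conj(f) g + χ^{2k+4} (conj(Xf) g + conj(f) Xg)`; the last integral is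
the sum of inner products, `∫ Ψ = ⟪M_{k+1} f, M_{k+1} g⟫`, and the first is
`(2k+4) ⟪M_k f, [χ' χ^{k+2} g]⟫` with `‖[χ' χ^{k+2} g]‖ ≤ C₁ ‖M_{k+1} g‖`. [folklore] -/
theorem exists_norm_inner_lieDeriv_add_le (X : (AutomorphyDatum.gl n K hcpt).arch.lie) :
    ∃ D : ℝ, 0 ≤ D ∧ ∀ (k : ℕ) (y : (AdelicGroupData.gl n K).Adelic) (f g : W),
      ‖⟪cutoffWeightMap hcpt hWc (k + 1) y (h.lieRep (archGroupGL_lie n K) (archGroupGL_carrier n K) X f),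
          cutoffWeightMap hcpt hWc (k + 1) y g⟫_ℂ +
        ⟪cutoffWeightMap hcpt hWc (k + 1) y f,
          cutoffWeightMap hcpt hWc (k + 1) y (h.lieRep (archGroupGL_lie n K) (archGroupGL_carrier n K) X g)⟫_ℂ‖ ≤
        D * (k + 2) * ‖cutoffWeightMap hcpt hWc k y f‖ * ‖cutoffWeightMap hcpt hWc (k + 1) y g‖ := by
  -- the divergence constant of the flow of `X` and the bound of `χ'`
  obtain ⟨κ, hκ⟩ := exists_flowDivergence (n := n) (K := K) (X : Matrix (Fin n) (Fin n) (mixedSpace K))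
  obtain ⟨C₁, hC₁0, hC₁⟩ := exists_bound_glCutoffDerivC (n := n) (K := K) (X : Matrix (Fin n) (Fin n) (mixedSpace K))
  refine ⟨‖κ‖ + 2 * C₁, by positivity, fun k y f g ↦ ?_⟩
  /- notation: `χ = glCutoffC`, `χ' = glCutoffDerivC X`, `F = orbitPull y f`, `G = orbitPull y g`,
  `F' = orbitPull y (X f)`, `G' = orbitPull y (X g)` -/
  have hf : Continuous (f : (AdelicGroupData.gl n K).Adelic → ℂ) := hWc f f.2
  have hg : Continuous (g : (AdelicGroupData.gl n K).Adelic → ℂ) := hWc g g.2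
  have hXf : Continuous (lieDeriv (AutomorphyDatum.gl n K hcpt).ofArch X f) := hWc _ (h.lie_mem X f f.2)
  have hXg : Continuous (lieDeriv (AutomorphyDatum.gl n K hcpt).ofArch X g) := hWc _ (h.lie_mem X g g.2)
  -- the products on the group and their pull-backs
  have hG₀c : Continuous (star (f : (AdelicGroupData.gl n K).Adelic → ℂ) * (g : (AdelicGroupData.gl n K).Adelic → ℂ)) := hf.star.mul hg
  have hG₁c : Continuous (star (lieDeriv (AutomorphyDatum.gl n K hcpt).ofArch X f) * (g : (AdelicGroupData.gl n K).Adelic → ℂ) +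
      star (f : (AdelicGroupData.gl n K).Adelic → ℂ) * lieDeriv (AutomorphyDatum.gl n K hcpt).ofArch X g) :=
    (hXf.star.mul hg).add (hf.star.mul hXg)
  have hG₀ : ∀ s, orbitPull hcpt y (star (f : (AdelicGroupData.gl n K).Adelic → ℂ) * (g : (AdelicGroupData.gl n K).Adelic → ℂ)) s =
      star (orbitPull hcpt y f s) * orbitPull hcpt y g s := fun s ↦ by
    rw [orbitPull_mul, orbitPull_star]; rfl
  have hG₁ : ∀ s, orbitPull hcpt y (star (lieDeriv (AutomorphyDatum.gl n K hcpt).ofArch X f) * (g : (AdelicGroupData.gl n K).Adelic → ℂ) +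
      star (f : (AdelicGroupData.gl n K).Adelic → ℂ) * lieDeriv (AutomorphyDatum.gl n K hcpt).ofArch X g) s =
      star (orbitPull hcpt y (lieDeriv (AutomorphyDatum.gl n K hcpt).ofArch X f) s) * orbitPull hcpt y g s +
        star (orbitPull hcpt y f s) * orbitPull hcpt y (lieDeriv (AutomorphyDatum.gl n K hcpt).ofArch X g) s :=
    fun s ↦ by rw [orbitPull_add, Pi.add_apply, orbitPull_mul, orbitPull_mul, orbitPull_star, orbitPull_star]; rfl
  -- `Ψ = χ^{2k+4} conj(F) G` and its flow derivative `Ψ'`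
  obtain ⟨Ψ, hΨ⟩ : ∃ Ψ : (GlIdx n K → ℝ) → ℂ, Ψ = fun s ↦ glCutoffC n K s ^ (2 * k + 4) *
      orbitPull hcpt y (star (f : (AdelicGroupData.gl n K).Adelic → ℂ) * (g : (AdelicGroupData.gl n K).Adelic → ℂ)) s := ⟨_, rfl⟩
  obtain ⟨T₁, hT₁⟩ : ∃ T₁ : (GlIdx n K → ℝ) → ℂ, T₁ = fun s ↦
      ((2 * k + 4 : ℕ) : ℂ) * glCutoffC n K s ^ (2 * k + 3) * glCutoffDerivC (X : Matrix (Fin n) (Fin n) (mixedSpace K)) s *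
        orbitPull hcpt y (star (f : (AdelicGroupData.gl n K).Adelic → ℂ) * (g : (AdelicGroupData.gl n K).Adelic → ℂ)) s := ⟨_, rfl⟩
  obtain ⟨T₂, hT₂⟩ : ∃ T₂ : (GlIdx n K → ℝ) → ℂ, T₂ = fun s ↦ glCutoffC n K s ^ (2 * k + 4) *
      orbitPull hcpt y (star (lieDeriv (AutomorphyDatum.gl n K hcpt).ofArch X f) * (g : (AdelicGroupData.gl n K).Adelic → ℂ) +
        star (f : (AdelicGroupData.gl n K).Adelic → ℂ) * lieDeriv (AutomorphyDatum.gl n K hcpt).ofArch X g) s := ⟨_, rfl⟩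
  have hΨc : Continuous Ψ := by
    rw [hΨ]
    exact continuous_mul_unitPull_of_tsupport_subset (continuous_glCutoffC_pow _)
      (tsupport_glCutoffC_pow_subset _) (continuous_orbit hcpt hG₀c y)
  have hΨs : HasCompactSupport Ψ := by
    rw [hΨ]; exact (hasCompactSupport_glCutoffC_pow _).mul_right
  have hT₁c : Continuous T₁ := by
    rw [hT₁]
    exact continuous_mul_unitPull_of_tsupport_subset
      ((continuous_const.mul (continuous_glCutoffC_pow _)).mul (continuous_glCutoffDerivC _))
      (tsupport_const_mul_glCutoffC_pow_mul_subset _ _ _) (continuous_orbit hcpt hG₀c y)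
  have hT₁s : HasCompactSupport T₁ := by
    rw [hT₁]
    exact (((hasCompactSupport_glCutoffC_pow (2 * k + 2)).mul_left).mul_right).mul_right
  have hT₂c : Continuous T₂ := by
    rw [hT₂]
    exact continuous_mul_unitPull_of_tsupport_subset (continuous_glCutoffC_pow _)
      (tsupport_glCutoffC_pow_subset _) (continuous_orbit hcpt hG₁c y)
  have hT₂s : HasCompactSupport T₂ := by
    rw [hT₂]; exact (hasCompactSupport_glCutoffC_pow _).mul_right
  -- the flow derivative of `Ψ` is `T₁ + T₂`
  have hflow : ∀ s, HasDerivAt (fun t : ℝ ↦ Ψ (rFlow (expGL (t • (X : Matrix (Fin n) (Fin n) (mixedSpace K))) :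
      Matrix (Fin n) (Fin n) (mixedSpace K)) s)) ((T₁ + T₂) s) 0 := by
    intro s
    have hχ := hasDerivAt_glCutoffC_rFlow (X : Matrix (Fin n) (Fin n) (mixedSpace K)) s
    have hF := hasDerivAt_orbitPull_rFlow hcpt (h.smooth f f.2) X y s
    have hG := hasDerivAt_orbitPull_rFlow hcpt (h.smooth g g.2) X y s
    have hprod := (hχ.pow (2 * k + 4)).mul ((HasDerivAt.star hF).mul hG)
    have e : (fun t : ℝ ↦ Ψ (rFlow (expGL (t • (X : Matrix (Fin n) (Fin n) (mixedSpace K))) :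
        Matrix (Fin n) (Fin n) (mixedSpace K)) s)) = fun t : ℝ ↦
        glCutoffC n K (rFlow (expGL (t • (X : Matrix (Fin n) (Fin n) (mixedSpace K))) : Matrix (Fin n) (Fin n) (mixedSpace K)) s) ^
            (2 * k + 4) *
          (star (orbitPull hcpt y f (rFlow (expGL (t • (X : Matrix (Fin n) (Fin n) (mixedSpace K))) :
              Matrix (Fin n) (Fin n) (mixedSpace K)) s)) *
            orbitPull hcpt y g (rFlow (expGL (t • (X : Matrix (Fin n) (Fin n) (mixedSpace K))) :
              Matrix (Fin n) (Fin n) (mixedSpace K)) s)) := by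
      funext t; simp only [hΨ, hG₀]
    rw [e]
    refine hprod.congr_deriv ?_
    have e1 : 2 * k + 4 - 1 = 2 * k + 3 := by omega
    rw [Pi.add_apply, hT₁, hT₂, e1]
    simp only [Pi.mul_apply, Pi.pow_apply, rFlow_expGL_zero_smul, hG₀, hG₁]
  -- integration by parts: `∫ (T₁ + T₂) = κ ∫ Ψ`
  have hdiv := hκ Ψ (T₁ + T₂) hΨc hΨs (hT₁c.add hT₂c) (hT₁s.add hT₂s) hflow
  have hT₁i : Integrable T₁ (volume : Measure (GlIdx n K → ℝ)) := hT₁c.integrable_of_hasCompactSupport hT₁s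
  have hT₂i : Integrable T₂ (volume : Measure (GlIdx n K → ℝ)) := hT₂c.integrable_of_hasCompactSupport hT₂s
  rw [integral_add' hT₁i hT₂i] at hdiv
  -- the auxiliary class `P = [χ' · M_{k+1} g]`
  have hPm : MemLp (fun s ↦ glCutoffDerivC (X : Matrix (Fin n) (Fin n) (mixedSpace K)) s * cutoffWeight hcpt (k + 1) y g s) 2
      (volume : Measure (GlIdx n K → ℝ)) :=
    ((continuous_glCutoffDerivC _).mul (continuous_cutoffWeight hcpt (k + 1) y hg)).memLp_of_hasCompactSupport
      (hasCompactSupport_cutoffWeight hcpt (k + 1) y g).mul_left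
  have hPle : ‖hPm.toLp _‖ ≤ C₁ * ‖cutoffWeightMap hcpt hWc (k + 1) y g‖ := by
    rw [cutoffWeightMap_apply]
    refine norm_toLp_le_mul_norm_cutoffWeightLp hcpt (k + 1) y hg hPm fun s ↦ ?_
    rw [norm_mul]
    exact mul_le_mul_of_nonneg_right (hC₁ s) (norm_nonneg _)
  -- the four integral identities
  have hA : ⟪cutoffWeightMap hcpt hWc (k + 1) y (h.lieRep (archGroupGL_lie n K) (archGroupGL_carrier n K) X f),
      cutoffWeightMap hcpt hWc (k + 1) y g⟫_ℂ =
      ∫ s, glCutoffC n K s ^ (2 * k + 4) *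
        (star (orbitPull hcpt y (lieDeriv (AutomorphyDatum.gl n K hcpt).ofArch X f) s) * orbitPull hcpt y g s) := by
    rw [cutoffWeightMap_apply, cutoffWeightMap_apply, cutoffWeightLp, cutoffWeightLp, inner_toLp_toLp_eq_integral_star_mul]
    refine integral_congr_ae (Eventually.of_forall fun s ↦ ?_)
    simp only [cutoffWeight_apply, star_mul, star_glCutoffC_pow, IsLieStableSmooth.coe_lieRep_apply]
    ring
  have hB : ⟪cutoffWeightMap hcpt hWc (k + 1) y f,
      cutoffWeightMap hcpt hWc (k + 1) y (h.lieRep (archGroupGL_lie n K) (archGroupGL_carrier n K) X g)⟫_ℂ =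
      ∫ s, glCutoffC n K s ^ (2 * k + 4) *
        (star (orbitPull hcpt y f s) * orbitPull hcpt y (lieDeriv (AutomorphyDatum.gl n K hcpt).ofArch X g) s) := by
    rw [cutoffWeightMap_apply, cutoffWeightMap_apply, cutoffWeightLp, cutoffWeightLp, inner_toLp_toLp_eq_integral_star_mul]
    refine integral_congr_ae (Eventually.of_forall fun s ↦ ?_)
    simp only [cutoffWeight_apply, star_mul, star_glCutoffC_pow, IsLieStableSmooth.coe_lieRep_apply]
    ring
  have hΨI : ⟪cutoffWeightMap hcpt hWc (k + 1) y f, cutoffWeightMap hcpt hWc (k + 1) y g⟫_ℂ = ∫ s, Ψ s := by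
    rw [cutoffWeightMap_apply, cutoffWeightMap_apply, cutoffWeightLp, cutoffWeightLp, inner_toLp_toLp_eq_integral_star_mul, hΨ]
    refine integral_congr_ae (Eventually.of_forall fun s ↦ ?_)
    simp only [cutoffWeight_apply, star_mul, star_glCutoffC_pow, hG₀]
    ring
  have hT₁I : ∫ s, T₁ s = ((2 * k + 4 : ℕ) : ℂ) * ⟪cutoffWeightMap hcpt hWc k y f, hPm.toLp _⟫_ℂ := by
    rw [cutoffWeightMap_apply, cutoffWeightLp, inner_toLp_toLp_eq_integral_star_mul, ← integral_const_mul, hT₁]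
    refine integral_congr_ae (Eventually.of_forall fun s ↦ ?_)
    simp only [cutoffWeight_apply, star_mul, star_glCutoffC_pow, hG₀]
    ring
  -- `∫ T₂` is the sum of the two inner products
  have hA_i : Integrable (fun s ↦ glCutoffC n K s ^ (2 * k + 4) *
      (star (orbitPull hcpt y (lieDeriv (AutomorphyDatum.gl n K hcpt).ofArch X f) s) * orbitPull hcpt y g s))
      (volume : Measure (GlIdx n K → ℝ)) := by
    have hc : Continuous fun s ↦ glCutoffC n K s ^ (2 * k + 4) *
        (star (orbitPull hcpt y (lieDeriv (AutomorphyDatum.gl n K hcpt).ofArch X f) s) * orbitPull hcpt y g s) := by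
      have := continuous_mul_unitPull_of_tsupport_subset (continuous_glCutoffC_pow (2 * k + 4))
        (tsupport_glCutoffC_pow_subset _) (continuous_orbit hcpt (hXf.star.mul hg) y)
      refine this.congr fun s ↦ ?_
      show glCutoffC n K s ^ (2 * k + 4) * orbitPull hcpt y
        (star (lieDeriv (AutomorphyDatum.gl n K hcpt).ofArch X f) * (g : (AdelicGroupData.gl n K).Adelic → ℂ)) s = _
      rw [orbitPull_mul, orbitPull_star]; rfl
    exact hc.integrable_of_hasCompactSupport (hasCompactSupport_glCutoffC_pow _).mul_right
  have hB_i : Integrable (fun s ↦ glCutoffC n K s ^ (2 * k + 4) *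
      (star (orbitPull hcpt y f s) * orbitPull hcpt y (lieDeriv (AutomorphyDatum.gl n K hcpt).ofArch X g) s))
      (volume : Measure (GlIdx n K → ℝ)) := by
    have hc : Continuous fun s ↦ glCutoffC n K s ^ (2 * k + 4) *
        (star (orbitPull hcpt y f s) * orbitPull hcpt y (lieDeriv (AutomorphyDatum.gl n K hcpt).ofArch X g) s) := by
      have := continuous_mul_unitPull_of_tsupport_subset (continuous_glCutoffC_pow (2 * k + 4))
        (tsupport_glCutoffC_pow_subset _) (continuous_orbit hcpt (hf.star.mul hXg) y)
      refine this.congr fun s ↦ ?_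
      show glCutoffC n K s ^ (2 * k + 4) * orbitPull hcpt y
        (star (f : (AdelicGroupData.gl n K).Adelic → ℂ) * lieDeriv (AutomorphyDatum.gl n K hcpt).ofArch X g) s = _
      rw [orbitPull_mul, orbitPull_star]; rfl
    exact hc.integrable_of_hasCompactSupport (hasCompactSupport_glCutoffC_pow _).mul_right
  have hT₂I : ∫ s, T₂ s =
      (∫ s, glCutoffC n K s ^ (2 * k + 4) *
        (star (orbitPull hcpt y (lieDeriv (AutomorphyDatum.gl n K hcpt).ofArch X f) s) * orbitPull hcpt y g s)) +
      ∫ s, glCutoffC n K s ^ (2 * k + 4) *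
        (star (orbitPull hcpt y f s) * orbitPull hcpt y (lieDeriv (AutomorphyDatum.gl n K hcpt).ofArch X g) s) := by
    rw [← integral_add hA_i hB_i, hT₂]
    refine integral_congr_ae (Eventually.of_forall fun s ↦ ?_)
    simp only [hG₁]
    ring
  -- assemble: the sum of inner products is `κ ⟪M f, M g⟫ - (2k+4) ⟪M_k f, P⟫`
  have hsum : ⟪cutoffWeightMap hcpt hWc (k + 1) y (h.lieRep (archGroupGL_lie n K) (archGroupGL_carrier n K) X f),
      cutoffWeightMap hcpt hWc (k + 1) y g⟫_ℂ +
      ⟪cutoffWeightMap hcpt hWc (k + 1) y f,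
        cutoffWeightMap hcpt hWc (k + 1) y (h.lieRep (archGroupGL_lie n K) (archGroupGL_carrier n K) X g)⟫_ℂ =
      κ * ⟪cutoffWeightMap hcpt hWc (k + 1) y f, cutoffWeightMap hcpt hWc (k + 1) y g⟫_ℂ -
        ((2 * k + 4 : ℕ) : ℂ) * ⟪cutoffWeightMap hcpt hWc k y f, hPm.toLp _⟫_ℂ := by
    rw [hA, hB, ← hT₂I, hΨI, ← hT₁I]
    linear_combination hdiv
  rw [hsum]
  -- norms
  have h1 : ‖κ * ⟪cutoffWeightMap hcpt hWc (k + 1) y f, cutoffWeightMap hcpt hWc (k + 1) y g⟫_ℂ‖ ≤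
      ‖κ‖ * (‖cutoffWeightMap hcpt hWc k y f‖ * ‖cutoffWeightMap hcpt hWc (k + 1) y g‖) := by
    rw [norm_mul]
    refine mul_le_mul_of_nonneg_left ((norm_inner_le_norm _ _).trans ?_) (norm_nonneg _)
    exact mul_le_mul_of_nonneg_right (norm_cutoffWeightMap_succ_le hcpt hWc k y f) (norm_nonneg _)
  have h2 : ‖((2 * k + 4 : ℕ) : ℂ) * ⟪cutoffWeightMap hcpt hWc k y f, hPm.toLp _⟫_ℂ‖ ≤
      (2 * k + 4) * (‖cutoffWeightMap hcpt hWc k y f‖ * (C₁ * ‖cutoffWeightMap hcpt hWc (k + 1) y g‖)) := by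
    rw [norm_mul, Complex.norm_natCast]
    push_cast
    refine mul_le_mul_of_nonneg_left ((norm_inner_le_norm _ _).trans ?_) (by positivity)
    exact mul_le_mul_of_nonneg_left hPle (norm_nonneg _)
  have hk0 : (0 : ℝ) ≤ k := Nat.cast_nonneg k
  have hM0 : 0 ≤ ‖cutoffWeightMap hcpt hWc k y f‖ * ‖cutoffWeightMap hcpt hWc (k + 1) y g‖ := by positivity
  calc _ ≤ ‖κ * ⟪cutoffWeightMap hcpt hWc (k + 1) y f, cutoffWeightMap hcpt hWc (k + 1) y g⟫_ℂ‖ +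
        ‖((2 * k + 4 : ℕ) : ℂ) * ⟪cutoffWeightMap hcpt hWc k y f, hPm.toLp _⟫_ℂ‖ := norm_sub_le _ _
    _ ≤ ‖κ‖ * (‖cutoffWeightMap hcpt hWc k y f‖ * ‖cutoffWeightMap hcpt hWc (k + 1) y g‖) +
        (2 * k + 4) * (‖cutoffWeightMap hcpt hWc k y f‖ * (C₁ * ‖cutoffWeightMap hcpt hWc (k + 1) y g‖)) :=
      add_le_add h1 h2
    _ = (‖κ‖ + 2 * C₁ * (k + 2)) * (‖cutoffWeightMap hcpt hWc k y f‖ * ‖cutoffWeightMap hcpt hWc (k + 1) y g‖) := by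
      ring
    _ ≤ ((‖κ‖ + 2 * C₁) * (k + 2)) * (‖cutoffWeightMap hcpt hWc k y f‖ * ‖cutoffWeightMap hcpt hWc (k + 1) y g‖) := by
      refine mul_le_mul_of_nonneg_right ?_ hM0
      have hκ0 : 0 ≤ ‖κ‖ := norm_nonneg κ
      nlinarith only [hκ0, hC₁0, hk0]
    _ = _ := by ring

end Defect

/-! ### 3. A size function on a finite-dimensional subspace -/

section Size

variable {W : Submodule ℂ ((AdelicGroupData.gl n K).Adelic → ℂ)} {T : Submodule ℂ W} {ιT : Type*} [Fintype ιT]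
  (bT : Module.Basis ιT ℂ T)

/-- **The coordinate size on `T`** attached to a finite basis `bT` of `T`: the sup-norm of the
coordinates (and `0` off `T`). Any norm on the finite-dimensional `T` would do; this one makes the
expansion `u = ∑ⱼ cⱼ bⱼ`, `|cⱼ| ≤ size u` explicit. [folklore] -/
def coordSize (u : W) : ℝ :=
  if hu : u ∈ T then ‖bT.equivFun ⟨u, hu⟩‖ else 0

/-- `0 ≤ coordSize bT u`. [folklore] -/
theorem coordSize_nonneg (u : W) : 0 ≤ coordSize bT u := by
  unfold coordSize; split_ifs <;> [exact norm_nonneg _; exact le_rfl]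

/-- `coordSize` on `T` is the norm of the coordinate vector. [folklore] -/
theorem coordSize_of_mem {u : W} (hu : u ∈ T) : coordSize bT u = ‖bT.equivFun ⟨u, hu⟩‖ := by
  unfold coordSize; rw [dif_pos hu]

/-- **Expansion in the basis with coordinates bounded by the size**: for `u ∈ T`,
`u = ∑ⱼ cⱼ bⱼ` with `‖cⱼ‖ ≤ coordSize bT u`. [folklore] -/
theorem eq_sum_coord_smul_basis {u : W} (hu : u ∈ T) :
    u = ∑ j, bT.equivFun ⟨u, hu⟩ j • ((bT j : T) : W) := by
  have e := bT.sum_equivFun ⟨u, hu⟩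
  have e' := congrArg (fun v : T ↦ (v : W)) e
  simp only [Submodule.coe_sum, Submodule.coe_smul_of_tower] at e'
  exact e'.symm

/-- The coordinates are bounded by the size. [folklore] -/
theorem norm_coord_le_coordSize {u : W} (hu : u ∈ T) (j : ιT) :
    ‖bT.equivFun ⟨u, hu⟩ j‖ ≤ coordSize bT u := by
  rw [coordSize_of_mem bT hu]; exact norm_le_pi_norm _ j

/-- **A linear map preserving `T` is bounded for the size**: `coordSize bT (L u) ≤ B coordSize bT u`
on `T`. [folklore] -/
theorem exists_coordSize_map_le (L : W →ₗ[ℂ] W) (hL : ∀ u ∈ T, L u ∈ T) :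
    ∃ B : ℝ, 0 ≤ B ∧ ∀ u ∈ T, coordSize bT (L u) ≤ B * coordSize bT u := by
  -- `L` restricted to `T`, transported to the coordinate space
  let LT : T →ₗ[ℂ] T := (L.domRestrict T).codRestrict T fun u ↦ hL u u.2
  let e := bT.equivFun
  let Lc : (ιT → ℂ) →L[ℂ] (ιT → ℂ) :=
    LinearMap.toContinuousLinearMap (e.toLinearMap ∘ₗ LT ∘ₗ e.symm.toLinearMap)
  refine ⟨‖Lc‖, norm_nonneg _, fun u hu ↦ ?_⟩
  have hLu : L u ∈ T := hL u hu
  rw [coordSize_of_mem bT hLu, coordSize_of_mem bT hu]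
  have key : e ⟨L u, hLu⟩ = Lc (e ⟨u, hu⟩) := by
    simp only [Lc, LT, LinearMap.coe_toContinuousLinearMap', LinearMap.coe_comp, LinearEquiv.coe_coe,
      Function.comp_apply, LinearEquiv.symm_apply_apply]
    rfl
  rw [key]
  exact Lc.le_opNorm _

end Size

/-! ### 4. The a-priori estimate for the unit generators on a `Δ`-stable finite-dimensional `T` -/

section APriori

variable {W : Submodule ℂ ((AdelicGroupData.gl n K).Adelic → ℂ)}
  (h : IsLieStableSmooth (AutomorphyDatum.gl n K hcpt) W) (hWc : ∀ φ ∈ W, Continuous φ)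
  {S : Type*} [Fintype S] (F : SelfDualUnits (mixedSpace K) S)

/-- **The a-priori estimate on `GL_n(K_∞)`-orbits** (Nelson 1959, §6, in cut-off form). Let `W` be a
Lie-stable space of continuous archimedean-smooth functions on `GL_n(𝔸_K)`, `X_p` the unit
generators of a self-dual system of units `F` of `K_∞`, and `T ≤ W` a finite-dimensional subspace
stable under Nelson's Laplacian `∑_p X_p²`. Then for all `nw ≤ m` there is `C ≥ 0` such that for
every base point `y ∈ GL_n(𝔸_K)`, every `Λ ≥ 0` with `‖M_0^{(y)} u‖ ≤ Λ · size u` on `T`, every word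
`β` of length `nw` in the `X_p` and every `u ∈ T`,
`‖M_m^{(y)} (X_β u)‖ ≤ C Λ size u` — the weighted local `L²`-norms near `y` of ALL derivatives of
the elements of `T` are controlled by the weighted local `L²`-norms of the elements of `T`
themselves, uniformly in `y`. (`Literature.Analysis.OperatorTheory.norm_weight_wordEnd_le` for the
operators `φ ↦ X_p φ` on `W`, the weights `cutoffWeightMap`, which are monotone and almost skew,
`exists_norm_inner_lieDeriv_add_le`.) [folklore] -/
theorem exists_norm_cutoffWeightMap_wordEnd_le {T : Submodule ℂ W} {ιT : Type*} [Fintype ιT]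
    (bT : Module.Basis ιT ℂ T)
    (hT : ∀ u ∈ T, (∑ p : S × Fin n × Fin n,
      h.lieRep (archGroupGL_lie n K) (archGroupGL_carrier n K) (unitGen F p) *
        h.lieRep (archGroupGL_lie n K) (archGroupGL_carrier n K) (unitGen F p)) u ∈ T)
    (nw m : ℕ) (hnm : nw ≤ m) :
    ∃ C : ℝ, 0 ≤ C ∧ ∀ (y : (AdelicGroupData.gl n K).Adelic) (Λ : ℝ), 0 ≤ Λ →
      (∀ u ∈ T, ‖cutoffWeightMap hcpt hWc 0 y u‖ ≤ Λ * coordSize bT u) →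
      ∀ β : List (S × Fin n × Fin n), β.length = nw → ∀ u ∈ T,
        ‖cutoffWeightMap hcpt hWc m y (Literature.Analysis.OperatorTheory.wordEnd
          (fun p ↦ h.lieRep (archGroupGL_lie n K) (archGroupGL_carrier n K) (unitGen F p)) β u)‖ ≤
          C * Λ * coordSize bT u := by
  classical
  have hH : (AutomorphyDatum.gl n K hcpt).arch.lie = ⊤ := archGroupGL_lie n K
  have hc : (AutomorphyDatum.gl n K hcpt).arch.carrier = ⊤ := archGroupGL_carrier n K
  set A : S × Fin n × Fin n → Module.End ℂ W := fun p ↦ h.lieRep hH hc (unitGen F p) with hA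
  -- structure constants of the unit generators (they span `𝔤`)
  have hspan : Submodule.span ℝ (Set.range (unitGen (N := Fin n) F)) = ⊤ := by
    rw [eq_top_iff]
    rintro Y -
    obtain ⟨x, rfl⟩ := exists_repr_unitGen F Y
    exact Submodule.sum_mem _ fun p _ ↦ Submodule.smul_mem _ _ (Submodule.subset_span ⟨p, rfl⟩)
  have hbr0 : ∀ i j, ⁅unitGen (N := Fin n) F i, unitGen F j⁆ ∈
      Submodule.span ℝ (Set.range (unitGen (N := Fin n) F)) := fun i j ↦ by rw [hspan]; trivial
  choose c hc' using fun i j ↦ (Submodule.mem_span_range_iff_exists_fun ℝ).mp (hbr0 i j)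
  have hbr : ∀ i j, ⁅unitGen (N := Fin n) F i, unitGen F j⁆ = ∑ l, c i j l • unitGen F l :=
    fun i j ↦ (hc' i j).symm
  have hbr' : ∀ i j, A i * A j - A j * A i = ∑ l, (c i j l : ℂ) • A l := fun i j ↦
    h.lieRep_mul_sub_mul_eq_sum hH hc (fun p ↦ unitGen F p) c hbr i j
  set cM : ℝ := ∑ i, ∑ j, ∑ l, |c i j l| with hcM
  have hcM0 : 0 ≤ cM := by positivity
  have hcle : ∀ i j l, |c i j l| ≤ cM := fun i j l ↦ by
    rw [hcM]
    refine le_trans ?_ (Finset.single_le_sum (f := fun i ↦ ∑ j, ∑ l, |c i j l|)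
      (fun _ _ ↦ by positivity) (Finset.mem_univ i))
    refine le_trans ?_ (Finset.single_le_sum (f := fun j ↦ ∑ l, |c i j l|)
      (fun _ _ ↦ by positivity) (Finset.mem_univ j))
    exact Finset.single_le_sum (f := fun l ↦ |c i j l|) (fun _ _ ↦ abs_nonneg _) (Finset.mem_univ l)
  -- the defect constants, one per letter; `D` their sum
  choose Dp hDp0 hDp using fun p : S × Fin n × Fin n ↦ exists_norm_inner_lieDeriv_add_le hcpt h hWc (unitGen F p)
  set D : ℝ := ∑ p, Dp p with hD
  have hD0 : 0 ≤ D := Finset.sum_nonneg fun p _ ↦ hDp0 p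
  have hDle : ∀ p, Dp p ≤ D := fun p ↦
    Finset.single_le_sum (f := Dp) (fun q _ ↦ hDp0 q) (Finset.mem_univ p)
  -- the bound of the Laplacian for the size
  have hΔT : ∀ u ∈ T, Literature.Analysis.OperatorTheory.laplacianEnd A u ∈ T := fun u hu ↦ hT u hu
  obtain ⟨B, hB0, hB⟩ := exists_coordSize_map_le bT (Literature.Analysis.OperatorTheory.laplacianEnd A) hΔT
  refine ⟨Literature.Analysis.OperatorTheory.aprioriBound B cM (Fintype.card (S × Fin n × Fin n)) D nw m,
    Literature.Analysis.OperatorTheory.aprioriBound_nonneg hcM0 hD0 _ nw m, fun y Λ hΛ0 hΛ β hβ u hu ↦ ?_⟩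
  -- the abstract estimate for the weights at `y` with the size `Λ · coordSize`
  have key := Literature.Analysis.OperatorTheory.norm_weight_wordEnd_le A c hbr' hcM0 hcle
    (fun m ↦ cutoffWeightMap hcpt hWc m y) (fun m f ↦ norm_cutoffWeightMap_succ_le hcpt hWc m y f) hD0
    ?_ hΔT (fun u ↦ Λ * coordSize bT u) (fun u _ ↦ mul_nonneg hΛ0 (coordSize_nonneg bT u)) hΛ hB0
    (fun u hu ↦ ?_) β m (hβ ▸ hnm) hu
  · rw [hβ] at key
    simpa only [mul_assoc] using key
  · -- almost skewness, letter by letter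
    intro m' hm' i f g
    obtain ⟨k, rfl⟩ : ∃ k : ℕ, m' = k + 1 := ⟨m' - 1, by omega⟩
    have hd := hDp i k y f g
    rw [Nat.add_sub_cancel]
    refine hd.trans ?_
    have e : (((k + 1 : ℕ) : ℝ) + 1) = (k : ℝ) + 2 := by push_cast; ring
    rw [e]
    have hk2 : (0 : ℝ) ≤ (k : ℝ) + 2 := by positivity
    exact mul_le_mul_of_nonneg_right (mul_le_mul_of_nonneg_right
      (mul_le_mul_of_nonneg_right (hDle i) hk2) (norm_nonneg _)) (norm_nonneg _)
  · -- the Laplacian bound for `Λ · coordSize`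
    calc Λ * coordSize bT (Literature.Analysis.OperatorTheory.laplacianEnd A u)
        ≤ Λ * (B * coordSize bT u) := mul_le_mul_of_nonneg_left (hB u hu) hΛ0
      _ = B * (Λ * coordSize bT u) := by ring

end APriori

end Literature.NumberTheory.Automorphic
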